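import Summits.BirchSwinnertonDyer.BirchSwinnertonDyer.Theorems.ErratumRoadFiveKatoFframeLocalLiftFixedPoints
import HarnessLib

/-!
# Route `ErratumRoadFive`, crux 19715 `EulerHalfNotRamNoInertSetAtFive`, line `kato_Fframe` (r5.4), stub S1Λ
# `stub_katoLambdaLogBoundTamagawa` — HELPER R-C (L), part 2, and (E): the DOOR-LIFT INPUT and the EXPONENT in the chain's currency

Seat `bsd-line-er5-p1` (LEAD g9), `--supports stmt-BirchSwinnertonDyer-19715` (helper). Theorems only: no definition, no named
fact, no instance, no notation, no `sorry`. No summit statement is proved here; BSD is proved for no curve.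

Part 1 (`…LocalLiftFixedPoints.lean`) proved the lift on `E(K̄)^{I_v}[p^∞]` (route p2's `FixedPoints.addSubgroup` of the inertia group
of `𝔓₀`, `decomp v`, an arithmetic Frobenius). THIS FILE restates it in the currency of the bsd-cm chain Parts 24–30
(`GaloisRep.restrictField K_v (primaryGaloisModule W p)` acting on `W.geomPrimaryTorsion p`, the local inertia group `absInertia K_v`):

* §3 **`exists_forall_le_lift`** — binder (L) of `Cruxes/EulerHalfNotRamNoInertSetAtFive/Lines/kato_Fframe_r5_RC_rethread_brief.md`
  VERBATIM = the hypothesis `hlift` of g40's `ErratumRoadFiveKatoFframeDoorLift.comap_map_unramifiedSubgroup_eq_sup_ker_of_lift` for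
  `ρB = E[p^∞]|_{Γ_{K_v}}`, `n = p^k`, all `k ≥ k₂`, at EVERY finite `v ∤ p`: bridges `I_{𝔓₀} = res (I_{K_v})`
  (`inertia_adicCompletionPrime_eq_map_absInertia`, Neukirch II (9.6)) and `D_v = res (Γ_{K_v})`, applied at a lift `σ_φ` of Frobenius.
* §4 **`exists_exponent_fixed`** — binder (E): one `e` with `p^e • X = 0` for every `Γ_{K_v}`-fixed `X ∈ E[p^∞]` (`E(K_v)[p^∞]` is finite,
  route p2's `finite_setOf_smul_decomp_eq_of_isPrimary`).

References: [GreenbergLNM1716] §3 Lemma 3.3 (p. 87), §4 proof of Thm. 4.1 (p. 74); [SilvermanAEC2009] VII.§2, Prop. VII.3.1,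
Thm. VII.6.1 / Cor. VII.6.2; [MilneADT2006] Ch. I Prop. 3.8; [NeukirchANT1999] Ch. II §9 Prop. (9.6).
-/

noncomputable section

open scoped Classical NNReal ContRepresentation

open NumberField IsDedekindDomain Field IsDedekindDomain.HeightOneSpectrum WeierstrassCurve
open Literature.NumberTheory.EllipticCurves Literature.NumberTheory.EllipticCurves.GreenbergSelmer
open Literature.NumberTheory.GaloisRepresentations
open Summit.BirchSwinnertonDyer.Rank1Residual.X11b.AcSelmer Summit.BirchSwinnertonDyer.Rank1Residual.X11b.LocBridge
open Summit.BirchSwinnertonDyer.BirchSwinnertonDyer.Theorems.ErratumRoadFiveKatoFframeLocalLiftFixedPoints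

set_option linter.dupNamespace false

universe u

namespace Summit.BirchSwinnertonDyer.BirchSwinnertonDyer.Theorems.ErratumRoadFiveKatoFframeLocalLift

variable {K : Type u} [Field K] [NumberField K] (W : WeierstrassCurve K) {p : ℕ} [Fact p.Prime]
  {v : HeightOneSpectrum (𝓞 K)}

/-! ## §3 The binder (L) of the re-thread brief, in the currency of the bsd-cm chain -/

section Local

omit [Fact p.Prime] in
/-- Unfolding: the local representation on `E[p^∞]` acts through `res : Γ_{K_v} → Γ_K` on points. [folklore] -/
theorem coe_restrictField_primaryGaloisModule_apply (σ : absoluteGaloisGroup (v.adicCompletion K))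
    (X : W.geomPrimaryTorsion p) :
    ((GaloisRep.restrictField (v.adicCompletion K) (primaryGaloisModule W p) σ X : W.geomPrimaryTorsion p) : W.geomPoints) =
      absGaloisRestrict K (v.adicCompletion K) σ • (X : W.geomPoints) := by
  rw [GaloisRep.restrictField_apply]
  rfl

omit [Fact p.Prime] in
/-- An `absInertia K_v`-fixed point of `E[p^∞]` (local currency) is an `I_{𝔓₀}`-fixed point of `E(K̄)` (`I_{𝔓₀} = res (I_{K_v})`,
Neukirch II (9.6)). [cite: NeukirchANT1999, Ch. II §9 Prop. (9.6)] -/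
theorem mem_fixedPoints_inertia_of_forall_absInertia (X : W.geomPrimaryTorsion p)
    (hX : ∀ τ ∈ absInertia (v.adicCompletion K),
      GaloisRep.restrictField (v.adicCompletion K) (primaryGaloisModule W p) τ X = X) :
    (X : W.geomPoints) ∈ FixedPoints.addSubgroup ↥((adicCompletionPrime K v).inertia (absoluteGaloisGroup K)) W.geomPoints := by
  intro i
  have hi : (i : absoluteGaloisGroup K) ∈
      (absInertia (v.adicCompletion K)).map (absGaloisRestrict K (v.adicCompletion K)).toMonoidHom := by
    rw [← inertia_adicCompletionPrime_eq_map_absInertia]; exact i.2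
  obtain ⟨τ, hτ, hτi⟩ := Subgroup.mem_map.mp hi
  have h := congrArg (fun z : W.geomPrimaryTorsion p ↦ (z : W.geomPoints)) (hX τ hτ)
  simp only [coe_restrictField_primaryGaloisModule_apply] at h
  change (i : absoluteGaloisGroup K) • (X : W.geomPoints) = X
  rw [← hτi]
  exact h

omit [Fact p.Prime] in
/-- Conversely an `I_{𝔓₀}`-fixed point of `E[p^∞]` is `absInertia K_v`-fixed in the local currency. [cite: NeukirchANT1999, Ch. II §9 Prop. (9.6)] -/
theorem restrictField_eq_of_mem_fixedPoints_inertia (X : W.geomPrimaryTorsion p)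
    (hX : (X : W.geomPoints) ∈
      FixedPoints.addSubgroup ↥((adicCompletionPrime K v).inertia (absoluteGaloisGroup K)) W.geomPoints)
    {τ : absoluteGaloisGroup (v.adicCompletion K)} (hτ : τ ∈ absInertia (v.adicCompletion K)) :
    GaloisRep.restrictField (v.adicCompletion K) (primaryGaloisModule W p) τ X = X := by
  have hmem : absGaloisRestrict K (v.adicCompletion K) τ ∈ (adicCompletionPrime K v).inertia (absoluteGaloisGroup K) := by
    rw [inertia_adicCompletionPrime_eq_map_absInertia]
    exact Subgroup.mem_map_of_mem _ hτ
  apply Subtype.ext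
  rw [coe_restrictField_primaryGaloisModule_apply]
  exact hX ⟨_, hmem⟩

omit [Fact p.Prime] in
/-- A `D_v`-fixed point of `E[p^∞]` is `Γ_{K_v}`-fixed in the local currency (`D_v = res (Γ_{K_v})`). [folklore] -/
theorem restrictField_eq_of_forall_decomp (X : W.geomPrimaryTorsion p)
    (hX : ∀ x ∈ decomp v, x • (X : W.geomPoints) = X) (σ : absoluteGaloisGroup (v.adicCompletion K)) :
    GaloisRep.restrictField (v.adicCompletion K) (primaryGaloisModule W p) σ X = X := by
  apply Subtype.ext
  rw [coe_restrictField_primaryGaloisModule_apply]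
  exact hX _ ⟨σ, rfl⟩

/-- **THE DOOR-LIFT INPUT (binder (L) of the re-thread brief) at every finite `v ∤ p`, every reduction type.**  For an elliptic curve
`E` over a number field `K`, a prime `p` and a finite place `v ∤ p`: `∃ k₂, ∀ k ≥ k₂`, every `absInertia K_v`-fixed
`y ∈ E[p^∞]` such that `σ y − y ∈ p^k · E[p^∞]^{I_v}` for all `σ ∈ Γ_{K_v}` is `m + p^k z` with `m` fixed by `Γ_{K_v}` and `z`
fixed by `absInertia K_v` — the hypothesis `hlift` of `ErratumRoadFiveKatoFframeDoorLift.comap_map_unramifiedSubgroup_eq_sup_ker_of_lift`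
for `ρB = E[p^∞]|_{Γ_{K_v}}`, `n = p^k` (§2 applied to `σ = ` a Frobenius lift). [cite: GreenbergLNM1716, §3 Lemma 3.3 (p. 87) and §4 proof of Thm. 4.1 (p. 74)]
[cite: SilvermanAEC2009, Thm. VII.6.1, Cor. VII.6.2, Props. VII.2.1–2.2, VII.3.1] [cite: MilneADT2006, Ch. I Prop. 3.8] -/
theorem exists_forall_le_lift [W.IsElliptic] (hpv : (p : 𝓞 K) ∉ v.asIdeal) :
    ∃ k₂ : ℕ, ∀ k, k₂ ≤ k →
      ∀ y : W.geomPrimaryTorsion p,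
        (∀ τ ∈ absInertia (v.adicCompletion K),
          GaloisRep.restrictField (v.adicCompletion K) (primaryGaloisModule W p) τ y = y) →
        (∀ σ : absoluteGaloisGroup (v.adicCompletion K), ∃ z : W.geomPrimaryTorsion p,
          (∀ τ ∈ absInertia (v.adicCompletion K),
            GaloisRep.restrictField (v.adicCompletion K) (primaryGaloisModule W p) τ z = z) ∧
          GaloisRep.restrictField (v.adicCompletion K) (primaryGaloisModule W p) σ y - y = p ^ k • z) →
        ∃ m : W.geomPrimaryTorsion p,
          (∀ σ : absoluteGaloisGroup (v.adicCompletion K),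
            GaloisRep.restrictField (v.adicCompletion K) (primaryGaloisModule W p) σ m = m) ∧
          ∃ z : W.geomPrimaryTorsion p,
            (∀ τ ∈ absInertia (v.adicCompletion K),
              GaloisRep.restrictField (v.adicCompletion K) (primaryGaloisModule W p) τ z = z) ∧
            y - m = p ^ k • z := by
  let Mfix := FixedPoints.addSubgroup ↥((adicCompletionPrime K v).inertia (absoluteGaloisGroup K)) W.geomPoints
  let B : AddSubgroup Mfix := AddCommGroup.primaryComponent Mfix p
  -- a Frobenius at `𝔓₀` and a lift of it to `Γ_{K_v}`
  obtain ⟨φ, hφ⟩ := exists_isArithFrobAt_of_mem_primesAbove_holds (adicCompletionPrime_mem_primesAbove K v)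
  have hφD : φ ∈ decomp v := (decomp_eq_decompositionSubgroup_adicCompletionPrime v).symm ▸ hφ.mem_stabilizer
  obtain ⟨σφ, hσφ⟩ : ∃ σφ : absoluteGaloisGroup (v.adicCompletion K), absGaloisRestrict K (v.adicCompletion K) σφ = φ :=
    MonoidHom.mem_range.mp hφD
  obtain ⟨c, hc⟩ := exists_forall_le_lift_fixedPoints W hpv hφ hφD
  -- from `E[p^∞]` (local currency) to `E(K̄)^{I_v}[p^∞]` and back
  have toB : ∀ X : W.geomPrimaryTorsion p, ∀ hX : (X : W.geomPoints) ∈ Mfix, (⟨(X : W.geomPoints), hX⟩ : Mfix) ∈ B := by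
    intro X hX
    obtain ⟨n, hn⟩ := (AddCommGroup.mem_primaryComponent).mp X.2
    exact (AddCommGroup.mem_primaryComponent).mpr ⟨n, Subtype.ext (by
      rw [AddSubgroupClass.coe_nsmul, ZeroMemClass.coe_zero]; exact hn)⟩
  refine ⟨c, fun k hk y hyI hyσ ↦ ?_⟩
  have hyM : (y : W.geomPoints) ∈ Mfix := mem_fixedPoints_inertia_of_forall_absInertia W y hyI
  set yB : Mfix := ⟨(y : W.geomPoints), hyM⟩ with hyB
  -- the hypothesis at the Frobenius lift
  obtain ⟨z, hzI, hz⟩ := hyσ σφ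
  have hzM : (z : W.geomPoints) ∈ Mfix := mem_fixedPoints_inertia_of_forall_absInertia W z hzI
  set zB : Mfix := ⟨(z : W.geomPoints), hzM⟩ with hzB
  have hψy : inertiaSubOne W.geomPoints φ hφD yB = p ^ k • zB := by
    apply Subtype.ext
    have h := congrArg (fun X : W.geomPrimaryTorsion p ↦ (X : W.geomPoints)) hz
    simp only [AddSubgroupClass.coe_sub, coe_restrictField_primaryGaloisModule_apply, hσφ, AddSubmonoidClass.coe_nsmul] at h
    rw [coe_inertiaSubOne_apply, AddSubmonoidClass.coe_nsmul]
    exact h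
  obtain ⟨m, hmB, hmD, z', hz'B, hyz'⟩ := hc k hk yB (toB y hyM) ⟨zB, toB z hzM, hψy⟩
  -- back to `E[p^∞]`
  obtain ⟨nm, hnm⟩ := (AddCommGroup.mem_primaryComponent).mp hmB
  obtain ⟨nz, hnz⟩ := (AddCommGroup.mem_primaryComponent).mp hz'B
  have hnm' : p ^ nm • ((m : Mfix) : W.geomPoints) = 0 := by
    have := congrArg (fun X : Mfix ↦ (X : W.geomPoints)) hnm
    simpa only [AddSubmonoidClass.coe_nsmul, ZeroMemClass.coe_zero] using this
  have hnz' : p ^ nz • ((z' : Mfix) : W.geomPoints) = 0 := by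
    have := congrArg (fun X : Mfix ↦ (X : W.geomPoints)) hnz
    simpa only [AddSubmonoidClass.coe_nsmul, ZeroMemClass.coe_zero] using this
  let mT : W.geomPrimaryTorsion p := ⟨((m : Mfix) : W.geomPoints), (AddCommGroup.mem_primaryComponent).mpr ⟨nm, hnm'⟩⟩
  let zT : W.geomPrimaryTorsion p := ⟨((z' : Mfix) : W.geomPoints), (AddCommGroup.mem_primaryComponent).mpr ⟨nz, hnz'⟩⟩
  refine ⟨mT, fun σ ↦ restrictField_eq_of_forall_decomp W mT hmD σ, zT,
    fun τ hτ ↦ restrictField_eq_of_mem_fixedPoints_inertia W zT z'.2 hτ, Subtype.ext ?_⟩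
  have h := congrArg (fun X : Mfix ↦ (X : W.geomPoints)) hyz'
  simp only [AddSubgroupClass.coe_sub, AddSubmonoidClass.coe_nsmul] at h
  rw [AddSubgroupClass.coe_sub, AddSubmonoidClass.coe_nsmul]
  exact h

end Local

/-! ## §4 The binder (E): one exponent kills the `Γ_{K_v}`-fixed `p^∞`-torsion -/

section Exponent

omit [Fact p.Prime] in
/-- **`E(K_v)[p^∞]` has finite exponent (binder (E) of the re-thread brief)**: at a finite `v ∤ p` there is `e` with `p^e • X = 0` for
every `Γ_{K_v}`-fixed `X ∈ E[p^∞]` — the `D_v`-fixed `p`-power torsion of `E(K̄)` is a finite set (route p2's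
`finite_setOf_smul_decomp_eq_of_isPrimary`: Silverman VII.3.1 + VII.6.2). [cite: SilvermanAEC2009, Prop. VII.3.1 and Cor. VII.6.2]
[cite: GreenbergLNM1716, §3 Lemma 3.3 (proof, p. 87)] -/
theorem exists_exponent_fixed [W.IsElliptic] (hpv : (p : 𝓞 K) ∉ v.asIdeal) :
    ∃ e : ℕ, ∀ X : W.geomPrimaryTorsion p,
      (∀ σ : absoluteGaloisGroup (v.adicCompletion K),
        GaloisRep.restrictField (v.adicCompletion K) (primaryGaloisModule W p) σ X = X) → p ^ e • X = 0 := by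
  have hfin := finite_setOf_smul_decomp_eq_of_isPrimary W p hpv
  set S := {m : W.geomPoints | (∀ x ∈ decomp v, x • m = m) ∧ ∃ k : ℕ, p ^ k • m = 0} with hS
  have hexp : ∀ m : W.geomPoints, ∃ k : ℕ, m ∈ S → p ^ k • m = 0 := fun m ↦ by
    by_cases hm : m ∈ S
    · obtain ⟨k, hk⟩ := hm.2; exact ⟨k, fun _ ↦ hk⟩
    · exact ⟨0, fun h ↦ absurd h hm⟩
  choose f hf using hexp
  refine ⟨hfin.toFinset.sup f, fun X hX ↦ ?_⟩
  have hXS : (X : W.geomPoints) ∈ S := by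
    refine ⟨fun x hx ↦ ?_, (AddCommGroup.mem_primaryComponent).mp X.2⟩
    obtain ⟨σ, rfl⟩ := MonoidHom.mem_range.mp hx
    have h := congrArg (fun z : W.geomPrimaryTorsion p ↦ (z : W.geomPoints)) (hX σ)
    simp only [coe_restrictField_primaryGaloisModule_apply] at h
    exact h
  have hle : f (X : W.geomPoints) ≤ hfin.toFinset.sup f := Finset.le_sup (hfin.mem_toFinset.mpr hXS)
  apply Subtype.ext
  obtain ⟨j, hj⟩ := Nat.exists_eq_add_of_le hle
  rw [AddSubmonoidClass.coe_nsmul, ZeroMemClass.coe_zero, hj, pow_add, mul_comm, mul_smul, hf _ hXS, smul_zero]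

end Exponent

end Summit.BirchSwinnertonDyer.BirchSwinnertonDyer.Theorems.ErratumRoadFiveKatoFframeLocalLift

end
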